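import Summits.ResolutionOfSingularities.ResolutionOfSingularities.Theorems.MarkedTransferCampaignW24ReducedBridgeQDatum
import HarnessLib

/-!
# The LEVEL-`q` bridge, part 3: one-step formulas at level `e ≥ 1` (`q = 2^e`, one variable, characteristic 2) for carriers
# `F = Φ_{q,r₀} G + R` — top residue `r₀`, passenger `R` below it (HIRONAKA-L · cell `res-hironaka` · slot W2.4 «bottom-member re-run»;
# generalises res-D-pv-020's `e = 1` files `…ReducedBridge{Run,DigitOne,Mixed}.lean`)

**HONEST FRAMING.** OURS throughout: kernel theorems connecting OURS objects of the cell (res-L1-k24's `CampaignW24.ReducedRun`, res-type-059's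
`CampaignW24.stepAt` etc., res-D-pv-020's `CampaignW24.ReducedBridge`). Nothing below is a statement of H. Hironaka's manuscript [Hironaka2017]
(lit key `paper:url-3343fd9e678b`), nothing asserts that any statement of it holds, nothing is a claim about resolution of singularities in
characteristic `p`; the manuscript stays «under review» (D-0012/D-0089). AI work, weaker than expert review. Written by res-D-pv-020 (W2.4 lineage).

## What is proved (`K` a field of characteristic 2; `0 < e ≤ ℓ`; `q = 2^e`; `F = Φ_{q,r₀} G + R`, `r₀ < q`, `ResIn q good R`, `good ⊆ PairLT · r₀`)
* `hasseD_top_of_level : ∂^{(r₀)}F = Ψ_q G`, `hasseD_qmul_of_level : ∂^{(q·k)}F = Φ_{q,r₀}(D^{(k)}G) + ∂^{(q·k)}R`; case exclusions at level `e`.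
* `stepAt_of_level_caseI` (`ord G = k ≥ 2`, `SoleBottom`, `w·u_* = 1`, any case witness): `stepAt … = Φ_{q,r₀}(canonStepI 2^{ℓ−e} G) + R′`,
  `R′` again a passenger with residues in `good`.
* `kBar_of_level : k̄ = q / r₀ + 1`; `pre_iterate_of_level`; `stepAt_of_level_caseIII` (`ord G = 1`):
  `stepAt … = Φ_{q,r₀}(canonStepIIIq 2^{ℓ−e} k̄ G) + R′` — the top residue class runs as the one-variable reduced run, the passenger never feeds back.
Hypotheses: each theorem's own binders; no FACT-LIST fact, no DEFECT binder. Standard axioms only.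
-/

noncomputable section

set_option linter.dupNamespace false -- mandated namespace of this single-conjunct summit

namespace Summit.ResolutionOfSingularities.ResolutionOfSingularities.Theorems

namespace CampaignW24

namespace ReducedBridge

open Literature.AlgebraicGeometry.Hironaka2017.S08UnitMonomial (StandardExpression)
open Literature.AlgebraicGeometry.Hironaka2017.S09LLUED
open Literature.AlgebraicGeometry.Hironaka2017.S09LLUED.TopFrontier
open Literature.AlgebraicGeometry.Hironaka2017.S09LLUED.TopDeriv
open Literature.AlgebraicGeometry.Hironaka2017.S09LLUED.FrontierDrop (expo)
open Literature.RingTheory.MvPowerSeries (hasseDeriv coeff_hasseDeriv)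
open CampaignW21 (xs hasseD)

variable {K : Type} [Field K]

/-! ## §3 One-step formulas at level `e` -/

section Step

variable [CharP K 2] {e ℓ : ℕ} {F R : MvPowerSeries (Fin 1) K} {G : PowerSeries K} {r₀ : ℕ} {good : ℕ → Prop}

/-- `∂^{(α+2β)}F = Ψ_q G`: the passenger is invisible, the top class loses its residue. [folklore] -/
theorem hasseD_top_of_level (hF : F = phiQ (2 ^ e) (two_pow_ne_zero' e) r₀ G + R) (hr₀ : r₀ < 2 ^ e)
    (hR : ResIn (2 ^ e) good R) (hgood : ∀ ρ, good ρ → PairLT ρ r₀) :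
    hasseD K 1 (Finsupp.single 0 r₀) F = psiQ (2 ^ e) (two_pow_ne_zero' e) G := by
  have h1 := hasseD_low_phiQ (K := K) (e := e) hr₀ le_rfl G
  have h2 := hasseD_top_eq_zero_of_resIn hr₀ hgood hR
  rw [Nat.choose_self, Nat.cast_one, one_smul, Nat.sub_self, phiQ_zero_left] at h1
  change hasseDeriv (Finsupp.single 0 r₀) (phiQ (2 ^ e) (two_pow_ne_zero' e) r₀ G) = _ at h1
  change hasseDeriv (Finsupp.single 0 r₀) R = 0 at h2
  show hasseDeriv (Finsupp.single 0 r₀) F = _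
  rw [hF, map_add, h1, h2, add_zero]

/-- `∂^{(q·k)}F = Φ_{q,r₀}(D^{(k)}G) + ∂^{(q·k)}R`. [folklore] -/
theorem hasseD_qmul_of_level (hF : F = phiQ (2 ^ e) (two_pow_ne_zero' e) r₀ G + R) (hr₀ : r₀ < 2 ^ e) (k : ℕ) :
    hasseD K 1 (Finsupp.single 0 (2 ^ e * k)) F =
      phiQ (2 ^ e) (two_pow_ne_zero' e) r₀ (ReducedRun.D k G) + hasseD K 1 (Finsupp.single 0 (2 ^ e * k)) R := by
  have h1 := hasseD_qmul_phiQ (K := K) (e := e) hr₀ k G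
  change hasseDeriv (Finsupp.single 0 (2 ^ e * k)) (phiQ (2 ^ e) (two_pow_ne_zero' e) r₀ G) = _ at h1
  show hasseDeriv (Finsupp.single 0 (2 ^ e * k)) F = _ + hasseDeriv (Finsupp.single 0 (2 ^ e * k)) R
  rw [hF, map_add, h1]

/-- No Case (II) at level `e` in one variable: `|α + 2β| = r₀ < q`. [folklore] -/
theorem not_isCaseII_of_level (hr₀ : r₀ < 2 ^ e) :
    ¬ IsCaseII 2 (2 ^ e) (Finsupp.single (0 : Fin 1) (r₀ % 2)) (Finsupp.single 0 (r₀ / 2)) := by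
  intro h
  rw [IsCaseII, single_digits, Finsupp.degree_single] at h
  omega

/-- No Case (III) when the bottom digit is `k ≠ 1` (`|qγ_*| = q·k ≠ q`). [folklore] -/
theorem not_isCaseIII_of_level {k : ℕ} (hk : k ≠ 1) (α β : Fin 1 →₀ ℕ) :
    ¬ IsCaseIII 2 (2 ^ e) α β (Finsupp.single (0 : Fin 1) k) := by
  intro h
  have := h.2.2.2
  rw [Finsupp.degree_single] at this
  exact hk this

/-- No Case (I) at bottom digit `1` (`|qγ_*| = q < 2q`). [folklore] -/
theorem not_isCaseI_of_level_one : ¬ IsCaseI (2 ^ e) (Finsupp.single (0 : Fin 1) 1) := by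
  intro h
  rw [IsCaseI, Finsupp.smul_single, Finsupp.degree_single, smul_eq_mul, mul_one] at h
  have := pow_pos (two_pos : 0 < 2) e
  omega

/-- **Case (I) step at level `e`** (bottom digit `k ≥ 2`; datum in `SoleBottom`, `w·u_* = 1`, any case witness): the top residue class
takes res-L1-k24's canonical reduced step at depth `2^{ℓ−e}`, the passenger keeps its residues. [folklore] -/
theorem stepAt_of_level_caseI (X : StandardExpression 2 (xs K 1) e ℓ F) (hF : F = phiQ (2 ^ e) (two_pow_ne_zero' e) r₀ G + R)
    (hr₀ : r₀ < 2 ^ e) (hR : ResIn (2 ^ e) good R) (hgood : ∀ ρ, good ρ → PairLT ρ r₀) (he : 0 < e) (hle : e ≤ ℓ)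
    (h0 : 0 < frontierLength X.support X.u) {k : ℕ} (hk : PowerSeries.order G = k) (h2k : 2 ≤ k)
    (hsole : SoleBottom 2 e ℓ X.support X.u) {w : MvPowerSeries (Fin 1) K} (hw : w * uStar X.support X.u = 1)
    (c : HFlat.Case 2 (2 ^ e) (alpha X.support X.u) (beta X.support X.u) (gammaStar X.support X.u)) :
    ∃ R' : MvPowerSeries (Fin 1) K, ResIn (2 ^ e) good R' ∧
      stepAt (xs K 1) (hasseD K 1) X w c =
        phiQ (2 ^ e) (two_pow_ne_zero' e) r₀ (ReducedRun.canonStepI (2 ^ (ℓ - e)) G) + R' := by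
  haveI : Fact (Nat.Prime 2) := ⟨Nat.prime_two⟩
  have hG : G ≠ 0 := fun h => by rw [h, PowerSeries.order_zero] at hk; exact ENat.top_ne_coe k hk
  obtain ⟨hα, hβ⟩ := alpha_beta_of_level X hF hr₀ hR hgood he hle hG
  have hγ := gammaStar_of_level X hF hr₀ hR hgood he hle h0 hk
  have hwinv := inv_of_level X hF hr₀ hR hgood he hle h0 hk hsole hw
  set u := ReducedRun.unitPart (2 ^ (ℓ - e)) k G with hu
  refine ⟨R - w * (psiQ (2 ^ e) (two_pow_ne_zero' e) G * hasseD K 1 (Finsupp.single 0 (2 ^ e * k)) R), ?_, ?_⟩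
  · refine hR.sub (ResIn.mul_left ?_ (ResIn.mul_left (isMultQ_psiQ _ G) (hR.hasseD_qmul k)))
    rw [hwinv]; exact isMultQ_psiQ _ _
  · have hII : ¬ IsCaseII 2 (2 ^ e) (alpha X.support X.u) (beta X.support X.u) := by
      rw [hα, hβ]; exact not_isCaseII_of_level hr₀
    have hIII : ¬ IsCaseIII 2 (2 ^ e) (alpha X.support X.u) (beta X.support X.u) (gammaStar X.support X.u) := by
      rw [hγ]; exact not_isCaseIII_of_level (by omega) _ _
    have hkn : (PowerSeries.order G).toNat = k := by rw [hk]; rfl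
    show F - op (xs K 1) (hasseD K 1) w 2 (2 ^ e) _ _ _ c F = _
    rw [op_eq_opI _ _ _ _ _ _ _ _ c hII hIII, hα, hβ, hγ, opI, HFlat.pre, single_digits, Finsupp.smul_single, smul_eq_mul,
      hasseD_top_of_level hF hr₀ hR hgood, hasseD_qmul_of_level hF hr₀ k, ReducedRun.canonStepI, hkn, ReducedRun.stepI,
      phiQ_sub, ← hu]
    conv_lhs => rw [hF]
    rw [hwinv]
    simp only [phiQ, map_mul]
    ring

/-- `k̄ = q / r₀ + 1` at the digit-1 datum of level `e` (`b(A,III,0) = |α+2β+q·e₀| − q = r₀ ≥ 1`). [folklore] -/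
theorem kBar_of_level (hr₀pos : 0 < r₀) :
    HFlat.kBar (2 ^ e) (HFlat.bAIII 2 (2 ^ e) (Finsupp.single (0 : Fin 1) (r₀ % 2)) (Finsupp.single 0 (r₀ / 2))
      (Finsupp.single 0 1)) = 2 ^ e / r₀ + 1 := by
  have h : Finsupp.single (0 : Fin 1) (r₀ % 2) + 2 • Finsupp.single (0 : Fin 1) (r₀ / 2) + 2 ^ e • Finsupp.single (0 : Fin 1) 1 =
      Finsupp.single 0 (r₀ + 2 ^ e) := by
    rw [single_digits, Finsupp.smul_single, ← Finsupp.single_add, smul_eq_mul, mul_one]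
  rw [HFlat.bAIII, h, Finsupp.degree_single, HFlat.kBar]
  have h1 : ((r₀ + 2 ^ e : ℕ) : ℤ) - ((2 ^ e : ℕ) : ℤ) = (r₀ : ℤ) := by push_cast; ring
  rw [h1, if_pos (by exact_mod_cast hr₀pos), Int.toNat_natCast]

/-- Iterates of `h♭` at level `e`: the top class carries `twinPre^{[j]} G`, the passenger keeps its residues. [folklore] -/
theorem pre_iterate_of_level (hr₀ : r₀ < 2 ^ e) (hgood : ∀ ρ, good ρ → PairLT ρ r₀) (G : PowerSeries K) :
    ∀ (j : ℕ) (R : MvPowerSeries (Fin 1) K), ResIn (2 ^ e) good R → ∃ R' : MvPowerSeries (Fin 1) K, ResIn (2 ^ e) good R' ∧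
      (HFlat.pre (hasseD K 1) 2 (2 ^ e) (Finsupp.single 0 (r₀ % 2)) (Finsupp.single 0 (r₀ / 2)) (Finsupp.single 0 1))^[j]
          (phiQ (2 ^ e) (two_pow_ne_zero' e) r₀ G + R) =
        phiQ (2 ^ e) (two_pow_ne_zero' e) r₀ (ReducedRun.twinPre^[j] G) + R'
  | 0, R, hR => ⟨R, hR, rfl⟩
  | j + 1, R, hR => by
    -- one application of `h♭` on `Φ G + R`
    have hstep : HFlat.pre (hasseD K 1) 2 (2 ^ e) (Finsupp.single 0 (r₀ % 2)) (Finsupp.single 0 (r₀ / 2)) (Finsupp.single 0 1)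
        (phiQ (2 ^ e) (two_pow_ne_zero' e) r₀ G + R) =
        phiQ (2 ^ e) (two_pow_ne_zero' e) r₀ (ReducedRun.twinPre G) +
          psiQ (2 ^ e) (two_pow_ne_zero' e) G * hasseD K 1 (Finsupp.single 0 (2 ^ e * 1)) R := by
      rw [HFlat.pre, single_digits, Finsupp.smul_single, smul_eq_mul, hasseD_top_of_level rfl hr₀ hR hgood,
        hasseD_qmul_of_level rfl hr₀ 1, mul_add, psiQ_mul_phiQ, ReducedRun.twinPre]
    have hR₁ : ResIn (2 ^ e) good (psiQ (2 ^ e) (two_pow_ne_zero' e) G * hasseD K 1 (Finsupp.single 0 (2 ^ e * 1)) R) :=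
      ResIn.mul_left (isMultQ_psiQ _ G) (hR.hasseD_qmul 1)
    obtain ⟨R', hR', h'⟩ := pre_iterate_of_level hr₀ hgood (ReducedRun.twinPre G) j _ hR₁
    exact ⟨R', hR', by rw [Function.iterate_succ_apply, hstep, h', Function.iterate_succ_apply]⟩

/-- **Case (III) step at level `e`** (bottom digit `1`; any case witness, necessarily Case (III); `k̄ = q / r₀ + 1`): the top residue class takes
the reduced Case-(III) step `canonStepIIIq 2^{ℓ−e} k̄`, the passenger keeps its residues. [folklore] -/
theorem stepAt_of_level_caseIII (X : StandardExpression 2 (xs K 1) e ℓ F) (hF : F = phiQ (2 ^ e) (two_pow_ne_zero' e) r₀ G + R)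
    (hr₀ : r₀ < 2 ^ e) (hr₀pos : 0 < r₀) (hR : ResIn (2 ^ e) good R) (hgood : ∀ ρ, good ρ → PairLT ρ r₀) (he : 0 < e) (hle : e ≤ ℓ)
    (h0 : 0 < frontierLength X.support X.u) (hk : PowerSeries.order G = (1 : ℕ))
    (hsole : SoleBottom 2 e ℓ X.support X.u) {w : MvPowerSeries (Fin 1) K} (hw : w * uStar X.support X.u = 1)
    (c : HFlat.Case 2 (2 ^ e) (alpha X.support X.u) (beta X.support X.u) (gammaStar X.support X.u)) :
    ∃ R' : MvPowerSeries (Fin 1) K, ResIn (2 ^ e) good R' ∧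
      stepAt (xs K 1) (hasseD K 1) X w c =
        phiQ (2 ^ e) (two_pow_ne_zero' e) r₀ (ReducedRun.canonStepIIIq (2 ^ (ℓ - e)) (2 ^ e / r₀ + 1) G) + R' := by
  haveI : Fact (Nat.Prime 2) := ⟨Nat.prime_two⟩
  have hG : G ≠ 0 := fun h => by rw [h, PowerSeries.order_zero] at hk; exact ENat.top_ne_coe _ hk
  obtain ⟨hα, hβ⟩ := alpha_beta_of_level X hF hr₀ hR hgood he hle hG
  have hγ := gammaStar_of_level X hF hr₀ hR hgood he hle h0 hk
  have hwinv := inv_of_level X hF hr₀ hR hgood he hle h0 hk hsole hw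
  set kb := 2 ^ e / r₀ + 1 with hkb
  set u := ReducedRun.unitPart (2 ^ (ℓ - e)) 1 G with hu
  obtain ⟨Rk, hRk, hiter⟩ := pre_iterate_of_level (K := K) hr₀ hgood G kb R hR
  refine ⟨R - w ^ (2 ^ kb - 1) * Rk, hR.sub (ResIn.mul_left ?_ hRk), ?_⟩
  · rw [hwinv, ← map_pow]; exact isMultQ_psiQ _ _
  · have hI : ¬ IsCaseI (2 ^ e) (gammaStar X.support X.u) := by rw [hγ]; exact not_isCaseI_of_level_one
    have hII : ¬ IsCaseII 2 (2 ^ e) (alpha X.support X.u) (beta X.support X.u) := by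
      rw [hα, hβ]; exact not_isCaseII_of_level hr₀
    show F - op (xs K 1) (hasseD K 1) w 2 (2 ^ e) _ _ _ c F = _
    rw [op_eq_opIII _ _ _ _ _ _ _ _ c hI hII, hα, hβ, hγ, opIII, HFlat.caseIII, kBar_of_level hr₀pos, ← hkb]
    conv_lhs => rw [hF, hiter]
    rw [ReducedRun.canonStepIIIq, ← hu, phiQ_sub, mul_add, hwinv, ← map_pow, psiQ_mul_phiQ]
    ring

end Step

end ReducedBridge

end CampaignW24

end Summit.ResolutionOfSingularities.ResolutionOfSingularities.Theorems

end
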